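import Summits.QuantumFields.YangMills.Theorems.UnitScaleTiltProp7SymFrameCovDefs
import Summits.QuantumFields.YangMills.Theorems.UnitScaleTiltProp8ChartDoubleBarOneStepLog
import HarnessLib

/-!
# [Balaban1985Averaging] (58), (82): the twisted staircase transporters and the COVARIANT frame — letters

W1 (part 1 of 2) of the (47)-twˢ plan (★★OWNER RULING g26-№12 (T-sym-frames), ACK 26 (2)), for the objects of ✓ `…Prop7SymFrameCovDefs`:
the twisted staircase transporters `tstairU U₀ W y i = W(Γᵢ)·U₀(Γᵢ)⁻¹` ((58)) and the covariant frame `vframeCovU U₀ W y = eml_i tstairU` ((82)).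

Letters (generic complete normed `ℂ`-algebra `𝔸` with `‖1‖ = 1`; `ℓ = (d+2)L`): one-block reads `‖U₀(b) − 1‖ ≤ s₀` (background),
`‖W(b) − 1‖ ≤ s₁` (field) and the DIFFERENCE read `‖W(b) − U₀(b)‖ ≤ δ` on the bonds with both ends in the block `y`.

* §1 `norm_tstairU_sub_one_sub_le`: `‖tstairU − 1 − (ΣΓ(W−1) − ΣΓ(U₀−1))‖ ≤ 42ℓ²(s₀+s₁)²`, `‖tstairU − 1‖ ≤ 9ℓ(s₀+s₁)` (at `48ℓ(s₀+s₁) ≤ 1`).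
* §2 `norm_vframeCovU_sub_one_sub_le`: the covariant frame to first order is the DIFFERENCE of the comb means,
  `‖vframeCovU − 1 − (λ̄_y(W−1) − λ̄_y(U₀−1))‖ ≤ 3000ℓ²(s₀+s₁)²`, `‖vframeCovU − 1‖ ≤ 36ℓ(s₀+s₁)` (at `120ℓ(s₀+s₁) ≤ 1`: the certified
  `eml` expansion wants `‖tstairU − 1‖ ≤ 1/12`); `norm_vframeCovU_sub_one_le_of_diff`: `‖vframeCovU − 1‖ ≤ ℓ·δ + 3000ℓ²(s₀+s₁)²`
  (exactly `1` at `W = U₀`).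

Part 2 (`…Prop7SymFrameOneStep`) assembles the one-step row for the covariant double bar (89).
No analytic axioms; rung R3 of the programme, not the Clay statement; the YM mass gap is NOT proved here.
-/

noncomputable section

open scoped BigOperators
open NormedSpace

namespace Summit.QuantumFields.YangMills.Theorems.Prop7SymAvgTwSym

open Literature.MathematicalPhysics.QuantumFieldTheory.Balaban1983to89
open T4Continuum BlockAveraging AveragingRT ExpMeanLog MatrixLog BlockAveragingEMLLinearised
open B10Eq27TorusAxialLog (holT gaugeActT gaugeActT_apply)
open BlockAveragingEMLAnalyticMean (norm_eml_one_add_sub_sub_mean_le)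
open Summit.QuantumFields.YangMills.Theorems.Prop8Chart
open Summit.QuantumFields.YangMills.Theorems.Prop8ChartDoubleBar

variable {P : Params} {j : ℕ}
variable {𝔸 : Type*} [NormedRing 𝔸] [NormedAlgebra ℂ 𝔸] [CompleteSpace 𝔸] [NormOneClass 𝔸]

/-! ## §1 The twisted staircase transporters `W(Γ)·U₀(Γ)⁻¹` ([Balaban1985Averaging] (58)) -/

omit [NormedAlgebra ℂ 𝔸] [CompleteSpace 𝔸] in
/-- A product `x·y⁻¹` of near-`1` units to first order: with `‖x − 1‖ ≤ a`, `‖x − 1 − σ‖ ≤ a₂`, `‖y − 1‖ ≤ b ≤ ½`, `‖y − 1 − τ‖ ≤ b₂`: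
`‖x·y⁻¹ − 1 − (σ − τ)‖ ≤ a₂ + b₂ + 2b² + 2ab` and `‖x·y⁻¹ − 1‖ ≤ a + 2b + 2ab`. [folklore] -/
theorem norm_mul_inv_sub_one_sub_le {x y : 𝔸ˣ} {σ τ : 𝔸} {a a₂ b b₂ : ℝ}
    (hx : ‖(x : 𝔸) - 1‖ ≤ a) (hxσ : ‖(x : 𝔸) - 1 - σ‖ ≤ a₂) (hy : ‖(y : 𝔸) - 1‖ ≤ b) (hb : b ≤ 1 / 2) (hyτ : ‖(y : 𝔸) - 1 - τ‖ ≤ b₂) :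
    ‖(x : 𝔸) * ((y⁻¹ : 𝔸ˣ) : 𝔸) - 1 - (σ - τ)‖ ≤ a₂ + (b₂ + 2 * b ^ 2) + 2 * a * b ∧
      ‖(x : 𝔸) * ((y⁻¹ : 𝔸ˣ) : 𝔸) - 1‖ ≤ a + 2 * b + 2 * a * b := by
  have ha0 : 0 ≤ a := (norm_nonneg _).trans hx
  have hyi : ‖((y⁻¹ : 𝔸ˣ) : 𝔸) - 1‖ ≤ 2 * b := norm_inv_sub_one_le_two_mul hy hb
  have hyi2 : ‖((y⁻¹ : 𝔸ˣ) : 𝔸) - 1 + ((y : 𝔸) - 1)‖ ≤ 2 * b ^ 2 := norm_inv_sub_one_add_le hy hb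
  -- `y⁻¹ − 1 − (−τ) = (y⁻¹ − 1 + (y − 1)) − (y − 1 − τ)`
  have hyiτ : ‖((y⁻¹ : 𝔸ˣ) : 𝔸) - 1 - (-τ)‖ ≤ b₂ + 2 * b ^ 2 := by
    have e : ((y⁻¹ : 𝔸ˣ) : 𝔸) - 1 - (-τ) = (((y⁻¹ : 𝔸ˣ) : 𝔸) - 1 + ((y : 𝔸) - 1)) - (((y : 𝔸) - 1) - τ) := by abel
    rw [e]
    calc _ ≤ 2 * b ^ 2 + b₂ := norm_sub_le_of_le hyi2 hyτ
      _ = b₂ + 2 * b ^ 2 := by ring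
  -- the product identity `xy′ − 1 − (σ + τ′) = (x−1)(y′−1) + (x−1−σ) + (y′−1−τ′)`
  have e : (x : 𝔸) * ((y⁻¹ : 𝔸ˣ) : 𝔸) - 1 - (σ - τ) =
      ((x : 𝔸) - 1) * (((y⁻¹ : 𝔸ˣ) : 𝔸) - 1) + (((x : 𝔸) - 1 - σ) + (((y⁻¹ : 𝔸ˣ) : 𝔸) - 1 - (-τ))) := by noncomm_ring
  have e' : (x : 𝔸) * ((y⁻¹ : 𝔸ˣ) : 𝔸) - 1 = ((x : 𝔸) - 1) * (((y⁻¹ : 𝔸ˣ) : 𝔸) - 1) + (((x : 𝔸) - 1) + (((y⁻¹ : 𝔸ˣ) : 𝔸) - 1)) := by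
    noncomm_ring
  have hprod : ‖((x : 𝔸) - 1) * (((y⁻¹ : 𝔸ˣ) : 𝔸) - 1)‖ ≤ a * (2 * b) := (norm_mul_le _ _).trans (mul_le_mul hx hyi (norm_nonneg _) ha0)
  constructor
  · rw [e]
    calc _ ≤ a * (2 * b) + (a₂ + (b₂ + 2 * b ^ 2)) := norm_add_le_of_le hprod (norm_add_le_of_le hxσ hyiτ)
      _ = _ := by ring
  · rw [e']
    calc _ ≤ a * (2 * b) + (a + 2 * b) := norm_add_le_of_le hprod (norm_add_le_of_le hx hyi)
      _ = _ := by ring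

omit [NormedAlgebra ℂ 𝔸] [CompleteSpace 𝔸] in
/-- **THE TWISTED STAIRCASE TRANSPORTER TO FIRST ORDER**: if `‖U₀(b) − 1‖ ≤ s₀` and `‖W(b) − 1‖ ≤ s₁` on the bonds of the block `y` and `48ℓ(s₀ + s₁) ≤ 1`, then
`‖W(Γ)U₀(Γ)⁻¹ − 1 − (Z_W(Γ) − Z₀(Γ))‖ ≤ 42·ℓ²(s₀+s₁)²` and `‖W(Γ)U₀(Γ)⁻¹ − 1‖ ≤ 9·ℓ(s₀+s₁)` (`Z_W = W − 1`, `Z₀ = U₀ − 1`, signed sums along the staircase).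
[cite: Balaban1985Averaging, (58) p.27, (122)-(123) p.36] -/
theorem norm_tstairU_sub_one_sub_le (hj : j + 1 ≤ P.m + P.K) {U₀ W : GaugeField P j 𝔸ˣ} (y : Site P (j + 1)) {s₀ s₁ : ℝ}
    (hs₀ : 0 ≤ s₀) (hs₁ : 0 ≤ s₁) (hℓ : 48 * (((P.d + 2) * P.L : ℕ) : ℝ) * (s₀ + s₁) ≤ 1)
    (hU₀ : ∀ b : PBond P j, blockOf b.src = y → blockOf b.tgt = y → ‖((U₀ b : 𝔸ˣ) : 𝔸) - 1‖ ≤ s₀)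
    (hW : ∀ b : PBond P j, blockOf b.src = y → blockOf b.tgt = y → ‖((W b : 𝔸ˣ) : 𝔸) - 1‖ ≤ s₁) (i : Idx P) :
    ‖((tstairU U₀ W y i : 𝔸ˣ) : 𝔸) - 1 -
        (walkSum (fun b => ((W b : 𝔸ˣ) : 𝔸) - 1) (walk (emb y) (stairWord i.2.1 (off i.1))) -
          walkSum (fun b => ((U₀ b : 𝔸ˣ) : 𝔸) - 1) (walk (emb y) (stairWord i.2.1 (off i.1))))‖ ≤
        42 * (((P.d + 2) * P.L : ℕ) : ℝ) ^ 2 * (s₀ + s₁) ^ 2 ∧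
      ‖((tstairU U₀ W y i : 𝔸ˣ) : 𝔸) - 1‖ ≤ 9 * (((P.d + 2) * P.L : ℕ) : ℝ) * (s₀ + s₁) := by
  set ℓ : ℝ := (((P.d + 2) * P.L : ℕ) : ℝ) with hℓ
  have hℓ0 : 0 ≤ ℓ := Nat.cast_nonneg _
  have h4₀ : 4 * ℓ * s₀ ≤ 1 := by nlinarith [mul_nonneg hℓ0 hs₀, mul_nonneg hℓ0 hs₁]
  have h4₁ : 4 * ℓ * s₁ ≤ 1 := by nlinarith [mul_nonneg hℓ0 hs₀, mul_nonneg hℓ0 hs₁]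
  obtain ⟨hx, hxσ⟩ := norm_holT_stair_sub_one_le hj y hs₁ h4₁ hW i
  obtain ⟨hy, hyτ⟩ := norm_holT_stair_sub_one_le hj y hs₀ h4₀ hU₀ i
  have hb : 4 * ℓ * s₀ ≤ 1 / 2 := by nlinarith [mul_nonneg hℓ0 hs₀, mul_nonneg hℓ0 hs₁]
  obtain ⟨h1, h2⟩ := norm_mul_inv_sub_one_sub_le hx hxσ hy hb hyτ
  refine ⟨h1.trans ?_, h2.trans ?_⟩
  · have : 10 * ℓ ^ 2 * s₁ ^ 2 + (10 * ℓ ^ 2 * s₀ ^ 2 + 2 * (4 * ℓ * s₀) ^ 2) + 2 * (4 * ℓ * s₁) * (4 * ℓ * s₀) =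
        ℓ ^ 2 * (10 * s₁ ^ 2 + 42 * s₀ ^ 2 + 32 * s₀ * s₁) := by ring
    rw [this]
    nlinarith [sq_nonneg ℓ, mul_nonneg hs₀ hs₁, sq_nonneg s₀, sq_nonneg s₁, mul_nonneg (sq_nonneg ℓ) (mul_nonneg hs₀ hs₁),
      mul_nonneg (sq_nonneg ℓ) (sq_nonneg s₀), mul_nonneg (sq_nonneg ℓ) (sq_nonneg s₁)]
  · have : 4 * ℓ * s₁ + 2 * (4 * ℓ * s₀) + 2 * (4 * ℓ * s₁) * (4 * ℓ * s₀) = ℓ * (4 * s₁ + 8 * s₀ + 32 * (ℓ * s₀) * s₁) := by ring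
    rw [this]
    have hℓs₀ : ℓ * s₀ ≤ 1 / 48 := by nlinarith [mul_nonneg hℓ0 hs₀, mul_nonneg hℓ0 hs₁]
    have : 4 * s₁ + 8 * s₀ + 32 * (ℓ * s₀) * s₁ ≤ 9 * (s₀ + s₁) := by nlinarith [mul_nonneg (mul_nonneg hℓ0 hs₀) hs₁]
    calc ℓ * (4 * s₁ + 8 * s₀ + 32 * (ℓ * s₀) * s₁) ≤ ℓ * (9 * (s₀ + s₁)) := mul_le_mul_of_nonneg_left this hℓ0
      _ = 9 * ℓ * (s₀ + s₁) := by ring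

/-! ## §2 The covariant `exp[mean log]` frame ((82)-sym) -/

/-- **THE COVARIANT FRAME TO FIRST ORDER**: with `λ̄_y(Z) = |I|⁻¹Σ_i Z(Γ^σ_{y→x})` and block reads `s₀` (background), `s₁` (field), `120ℓ(s₀+s₁) ≤ 1`:
`‖v_{U₀}(W)(y) − 1 − (λ̄_y(W − 1) − λ̄_y(U₀ − 1))‖ ≤ 3000·ℓ²(s₀+s₁)²` and `‖v_{U₀}(W)(y) − 1‖ ≤ 36·ℓ(s₀+s₁)`.
[cite: Balaban1985Averaging, (62) p.28, (82) p.30] -/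
theorem norm_vframeCovU_sub_one_sub_le (hj : j + 1 ≤ P.m + P.K) {U₀ W : GaugeField P j 𝔸ˣ} (y : Site P (j + 1)) {s₀ s₁ : ℝ}
    (hs₀ : 0 ≤ s₀) (hs₁ : 0 ≤ s₁) (hℓ : 120 * (((P.d + 2) * P.L : ℕ) : ℝ) * (s₀ + s₁) ≤ 1)
    (hU₀ : ∀ b : PBond P j, blockOf b.src = y → blockOf b.tgt = y → ‖((U₀ b : 𝔸ˣ) : 𝔸) - 1‖ ≤ s₀)
    (hW : ∀ b : PBond P j, blockOf b.src = y → blockOf b.tgt = y → ‖((W b : 𝔸ˣ) : 𝔸) - 1‖ ≤ s₁) :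
    ‖((vframeCovU U₀ W y : 𝔸ˣ) : 𝔸) - 1 -
        (((Fintype.card (Idx P) : ℂ))⁻¹ • ∑ i : Idx P, walkSum (fun b => ((W b : 𝔸ˣ) : 𝔸) - 1) (walk (emb y) (stairWord i.2.1 (off i.1))) -
          ((Fintype.card (Idx P) : ℂ))⁻¹ • ∑ i : Idx P, walkSum (fun b => ((U₀ b : 𝔸ˣ) : 𝔸) - 1) (walk (emb y) (stairWord i.2.1 (off i.1))))‖ ≤
        3000 * (((P.d + 2) * P.L : ℕ) : ℝ) ^ 2 * (s₀ + s₁) ^ 2 ∧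
      ‖((vframeCovU U₀ W y : 𝔸ˣ) : 𝔸) - 1‖ ≤ 36 * (((P.d + 2) * P.L : ℕ) : ℝ) * (s₀ + s₁) := by
  rw [coe_vframeCovU]
  set ℓ : ℝ := (((P.d + 2) * P.L : ℕ) : ℝ) with hℓ
  have hℓ0 : 0 ≤ ℓ := Nat.cast_nonneg _
  have hS0 : 0 ≤ s₀ + s₁ := add_nonneg hs₀ hs₁
  have h48 : 48 * ℓ * (s₀ + s₁) ≤ 1 := by nlinarith [mul_nonneg hℓ0 hS0]
  set θ : ℝ := 9 * ℓ * (s₀ + s₁) with hθ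
  have hθ0 : 0 ≤ θ := by positivity
  have hθ12 : θ ≤ 1 / 12 := by rw [hθ]; nlinarith [mul_nonneg hℓ0 hS0]
  set V : Idx P → 𝔸 := fun i => ((tstairU U₀ W y i : 𝔸ˣ) : 𝔸) - 1 with hV
  have hVi : ∀ i, ‖V i‖ ≤ θ := fun i => (norm_tstairU_sub_one_sub_le hj y hs₀ hs₁ h48 hU₀ hW i).2
  have hVn : ‖V‖ ≤ θ := (pi_norm_le_iff_of_nonneg hθ0).2 hVi
  have hWf : (fun i : Idx P => ((tstairU U₀ W y i : 𝔸ˣ) : 𝔸)) = 1 + V := by funext i; simp [hV]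
  have heml := norm_eml_one_add_sub_sub_mean_le (ι := Idx P) (𝔸 := 𝔸) (V := V) (hVn.trans hθ12)
  rw [B7TransferAnalyticMean.meanCLM_apply] at heml
  have heml' : ‖eml (1 + V) - 1 - ((Fintype.card (Idx P) : ℂ))⁻¹ • ∑ i, V i‖ ≤ 36 * θ ^ 2 :=
    heml.trans (by nlinarith [pow_le_pow_left₀ (norm_nonneg V) hVn 2])
  -- the mean of `V` vs the mean of the signed-sum differences
  have herr : ‖((Fintype.card (Idx P) : ℂ))⁻¹ • ∑ i, V i -
      (((Fintype.card (Idx P) : ℂ))⁻¹ • ∑ i : Idx P, walkSum (fun b => ((W b : 𝔸ˣ) : 𝔸) - 1) (walk (emb y) (stairWord i.2.1 (off i.1))) -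
        ((Fintype.card (Idx P) : ℂ))⁻¹ • ∑ i : Idx P, walkSum (fun b => ((U₀ b : 𝔸ˣ) : 𝔸) - 1) (walk (emb y) (stairWord i.2.1 (off i.1))))‖ ≤
      42 * ℓ ^ 2 * (s₀ + s₁) ^ 2 := by
    rw [← smul_sub, ← Finset.sum_sub_distrib, ← smul_sub, ← Finset.sum_sub_distrib]
    exact norm_card_inv_smul_sum_le (by positivity) fun i => (norm_tstairU_sub_one_sub_le hj y hs₀ hs₁ h48 hU₀ hW i).1
  rw [hWf]
  constructor
  · have e : eml (1 + V) - 1 -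
        (((Fintype.card (Idx P) : ℂ))⁻¹ • ∑ i : Idx P, walkSum (fun b => ((W b : 𝔸ˣ) : 𝔸) - 1) (walk (emb y) (stairWord i.2.1 (off i.1))) -
          ((Fintype.card (Idx P) : ℂ))⁻¹ • ∑ i : Idx P, walkSum (fun b => ((U₀ b : 𝔸ˣ) : 𝔸) - 1) (walk (emb y) (stairWord i.2.1 (off i.1)))) =
        (eml (1 + V) - 1 - ((Fintype.card (Idx P) : ℂ))⁻¹ • ∑ i, V i) +
          (((Fintype.card (Idx P) : ℂ))⁻¹ • ∑ i, V i -
            (((Fintype.card (Idx P) : ℂ))⁻¹ • ∑ i : Idx P, walkSum (fun b => ((W b : 𝔸ˣ) : 𝔸) - 1) (walk (emb y) (stairWord i.2.1 (off i.1))) -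
              ((Fintype.card (Idx P) : ℂ))⁻¹ • ∑ i : Idx P, walkSum (fun b => ((U₀ b : 𝔸ˣ) : 𝔸) - 1) (walk (emb y) (stairWord i.2.1 (off i.1))))) := by
      abel
    rw [e]
    calc _ ≤ 36 * θ ^ 2 + 42 * ℓ ^ 2 * (s₀ + s₁) ^ 2 := norm_add_le_of_le heml' herr
      _ = 2958 * ℓ ^ 2 * (s₀ + s₁) ^ 2 := by rw [hθ]; ring
      _ ≤ 3000 * ℓ ^ 2 * (s₀ + s₁) ^ 2 := by nlinarith [sq_nonneg (ℓ * (s₀ + s₁))]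
  · have hmean : ‖((Fintype.card (Idx P) : ℂ))⁻¹ • ∑ i, V i‖ ≤ θ := norm_card_inv_smul_sum_le hθ0 hVi
    have e : eml (1 + V) - 1 = (eml (1 + V) - 1 - ((Fintype.card (Idx P) : ℂ))⁻¹ • ∑ i, V i) + ((Fintype.card (Idx P) : ℂ))⁻¹ • ∑ i, V i := by abel
    rw [e]
    calc _ ≤ 36 * θ ^ 2 + θ := norm_add_le_of_le heml' hmean
      _ ≤ 4 * θ := by nlinarith
      _ = 36 * ℓ * (s₀ + s₁) := by rw [hθ]; ring

omit [NormedAlgebra ℂ 𝔸] [CompleteSpace 𝔸] [NormOneClass 𝔸] in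
/-- A staircase sum of the DIFFERENCE field `W − U₀` inside the block `y` is at most `ℓ·δ`. [cite: Balaban1987RG1, (0.3) p.252] -/
theorem norm_walkSum_stair_diff_le (hj : j + 1 ≤ P.m + P.K) {U₀ W : GaugeField P j 𝔸ˣ} (y : Site P (j + 1)) {δ : ℝ} (hδ : 0 ≤ δ)
    (hd : ∀ b : PBond P j, blockOf b.src = y → blockOf b.tgt = y → ‖((W b : 𝔸ˣ) : 𝔸) - ((U₀ b : 𝔸ˣ) : 𝔸)‖ ≤ δ) (i : Idx P) :
    ‖walkSum (fun b => ((W b : 𝔸ˣ) : 𝔸) - ((U₀ b : 𝔸ˣ) : 𝔸)) (walk (emb y) (stairWord i.2.1 (off i.1)))‖ ≤ (((P.d + 2) * P.L : ℕ) : ℝ) * δ := by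
  refine (norm_walkSum_le_of_steps (s := δ) _ _ fun st hst => ?_).trans ?_
  · obtain ⟨h1, h2⟩ := blockOf_ends_of_mem_stairWalk hj y i.1 i.2.1 st hst
    exact hd st.bond h1 h2
  · have : ((walk (emb y) (stairWord i.2.1 (off i.1))).length : ℝ) ≤ (((P.d + 2) * P.L : ℕ) : ℝ) := by
      exact_mod_cast length_walk_stairWord_le (emb y) i.2.1 i.1
    exact mul_le_mul_of_nonneg_right this hδ

/-- **THE COVARIANT FRAME IS `ℓδ`-CLOSE TO `1` TO FIRST ORDER IN THE DIFFERENCE READS** (`‖W(b) − U₀(b)‖ ≤ δ` inside the block; it is `1` exactly at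
`W = U₀`): `‖v_{U₀}(W)(y) − 1‖ ≤ ℓ·δ + 3000·ℓ²(s₀+s₁)²`. [cite: Balaban1985Averaging, (62) p.28, (82) p.30] -/
theorem norm_vframeCovU_sub_one_le_of_diff (hj : j + 1 ≤ P.m + P.K) {U₀ W : GaugeField P j 𝔸ˣ} (y : Site P (j + 1)) {s₀ s₁ δ : ℝ}
    (hs₀ : 0 ≤ s₀) (hs₁ : 0 ≤ s₁) (hδ : 0 ≤ δ) (hℓ : 120 * (((P.d + 2) * P.L : ℕ) : ℝ) * (s₀ + s₁) ≤ 1)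
    (hU₀ : ∀ b : PBond P j, blockOf b.src = y → blockOf b.tgt = y → ‖((U₀ b : 𝔸ˣ) : 𝔸) - 1‖ ≤ s₀)
    (hW : ∀ b : PBond P j, blockOf b.src = y → blockOf b.tgt = y → ‖((W b : 𝔸ˣ) : 𝔸) - 1‖ ≤ s₁)
    (hd : ∀ b : PBond P j, blockOf b.src = y → blockOf b.tgt = y → ‖((W b : 𝔸ˣ) : 𝔸) - ((U₀ b : 𝔸ˣ) : 𝔸)‖ ≤ δ) :
    ‖((vframeCovU U₀ W y : 𝔸ˣ) : 𝔸) - 1‖ ≤ (((P.d + 2) * P.L : ℕ) : ℝ) * δ + 3000 * (((P.d + 2) * P.L : ℕ) : ℝ) ^ 2 * (s₀ + s₁) ^ 2 := by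
  have h1 := (norm_vframeCovU_sub_one_sub_le hj y hs₀ hs₁ hℓ hU₀ hW).1
  have hm : ‖((Fintype.card (Idx P) : ℂ))⁻¹ • ∑ i : Idx P, walkSum (fun b => ((W b : 𝔸ˣ) : 𝔸) - 1) (walk (emb y) (stairWord i.2.1 (off i.1))) -
      ((Fintype.card (Idx P) : ℂ))⁻¹ • ∑ i : Idx P, walkSum (fun b => ((U₀ b : 𝔸ˣ) : 𝔸) - 1) (walk (emb y) (stairWord i.2.1 (off i.1)))‖ ≤
      (((P.d + 2) * P.L : ℕ) : ℝ) * δ := by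
    rw [← smul_sub, ← Finset.sum_sub_distrib]
    refine norm_card_inv_smul_sum_le (by positivity) fun i => ?_
    rw [← walkSum_sub']
    have e : ((fun b : PBond P j => ((W b : 𝔸ˣ) : 𝔸) - 1) - fun b => ((U₀ b : 𝔸ˣ) : 𝔸) - 1) = fun b => ((W b : 𝔸ˣ) : 𝔸) - ((U₀ b : 𝔸ˣ) : 𝔸) := by
      funext b; simp only [Pi.sub_apply]; abel
    rw [e]
    exact norm_walkSum_stair_diff_le hj y hδ hd i
  have e : ((vframeCovU U₀ W y : 𝔸ˣ) : 𝔸) - 1 = (((vframeCovU U₀ W y : 𝔸ˣ) : 𝔸) - 1 -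
      (((Fintype.card (Idx P) : ℂ))⁻¹ • ∑ i : Idx P, walkSum (fun b => ((W b : 𝔸ˣ) : 𝔸) - 1) (walk (emb y) (stairWord i.2.1 (off i.1))) -
        ((Fintype.card (Idx P) : ℂ))⁻¹ • ∑ i : Idx P, walkSum (fun b => ((U₀ b : 𝔸ˣ) : 𝔸) - 1) (walk (emb y) (stairWord i.2.1 (off i.1))))) +
      (((Fintype.card (Idx P) : ℂ))⁻¹ • ∑ i : Idx P, walkSum (fun b => ((W b : 𝔸ˣ) : 𝔸) - 1) (walk (emb y) (stairWord i.2.1 (off i.1))) -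
        ((Fintype.card (Idx P) : ℂ))⁻¹ • ∑ i : Idx P, walkSum (fun b => ((U₀ b : 𝔸ˣ) : 𝔸) - 1) (walk (emb y) (stairWord i.2.1 (off i.1)))) := by abel
  rw [e]
  calc _ ≤ 3000 * (((P.d + 2) * P.L : ℕ) : ℝ) ^ 2 * (s₀ + s₁) ^ 2 + (((P.d + 2) * P.L : ℕ) : ℝ) * δ := norm_add_le_of_le h1 hm
    _ = _ := by ring

end Summit.QuantumFields.YangMills.Theorems.Prop7SymAvgTwSym

end
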